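import Literature.Analysis.FluidPDE.NSFourierTimeRegularity
import Literature.Analysis.FluidPDE.NSFourierSynthesis
import Literature.Analysis.FluidPDE.NSFourierData
import Literature.Analysis.FluidPDE.NSFourierDictionary
import Literature.Analysis.FluidPDE.ClassicalSolution
import HarnessLib

/-!
# Leray's local regular solution, synthesized from the Fourier-side fixed point

Tenth file of the Fourier-side construction of Leray's local regular solution
(`Literature.Analysis.FluidPDE.local_regular_solution_exists` in `NSLocalRegular`, the existence half of the named fact
`Literature.Analysis.FluidPDE.local_classical_lerayHopf`). Given Clay data — a viscosity
`ν > 0` and a smooth, divergence-free, rapidly decaying `u₀ : E → E`, `E = EuclideanSpace ℝ ι`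
(Fefferman (4)) — bundled as `ClayDatum ι`, we define

* the Fourier datum `a = 𝓕⁻ u₀^ℂ` (`NSFourierData`), the radius `R = 2A` (`A` its order-`K₀`
  decay constant, `K₀ = card ι + 1`), the rate `c = 4π²ν`, Picard's time
  `T = picardTime ι c K₀ R` and the fixed point `v = picardLimit c T a` (`NSFourierPicard`);
* the velocity `u(t, x) = Re 𝓕 v(t)(x)` and the pressure `p(t, x) = Re 𝓕 q(t)(x)`,
  `q(t) = presSymbol (v t) (v t)`,

and prove that `(u, p)` is a **classical solution of the Navier–Stokes system on the closed slab
`[0, T] × E`** with `u 0 = u₀` (`ClayDatum.isClassicalNSSolutionOn`, `ClayDatum.u_zero`):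
smoothness from `NSFourierSynthesis` and the families of `NSFourierTimeRegularity`; the
equations term by term through the dictionary `NSFourierDictionary` (`∂ₜ ↔ -c‖ξ‖² - N`,
`∂_h ↔ -2πi⟪ξ,h⟫`, `Δ ↔ -4π²‖ξ‖²`, products ↔ convolutions), the incompressibility of `v`, and
the pointwise Fourier-side identity `G - N - 2πi ξ q = 0` between the transformed convective
term `G`, its Leray projection `N` and the pressure symbol `q` (Leray 1934, §19; Ożański–Pooley
2018, Thm. 6.22, Cor. 6.16; Lemarié-Rieusset 2016, §6.1).

## References

* J. Leray, Acta Math. 63 (1934), §19. [Leray1934]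
* W. S. Ożański, B. C. Pooley, LMS LN 452, CUP 2018, Thm. 6.22, Cor. 6.16. [OzanskiPooley2018]
* P. G. Lemarié-Rieusset, *The Navier–Stokes problem in the 21st century*, CRC 2016, §6.1, §8.5.
-/

noncomputable section

open MeasureTheory Real Set Filter Topology Function Complex FourierTransform VectorFourier
  InnerProductSpace
open scoped FourierTransform RealInnerProductSpace ENNReal ContDiff ComplexConjugate Laplacian

namespace Literature.Analysis.FluidPDE.FourierNS

variable {ι : Type*} [Fintype ι] [DecidableEq ι]

/-- Clay data on `E = EuclideanSpace ℝ ι`: a viscosity `ν > 0` and a smooth, divergence-free,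
rapidly decaying initial velocity (Fefferman, Clay problem description, (4) and `ν > 0`). [folklore] -/
structure ClayDatum (ι : Type*) [Fintype ι] where
  /-- the viscosity -/
  ν : ℝ
  /-- positivity of the viscosity -/
  hν : 0 < ν
  /-- the initial velocity -/
  u₀ : EuclideanSpace ℝ ι → EuclideanSpace ℝ ι
  /-- smoothness (Fefferman (4)) -/
  smooth : ContDiff ℝ ∞ u₀
  /-- incompressibility (Fefferman (2) at `t = 0`) -/
  divFree : Literature.Analysis.FluidPDE.NSWave0.IsDivFree u₀
  /-- rapid decay of all derivatives (Fefferman (4)) -/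
  decay : Literature.Analysis.FluidPDE.HasRapidSpatialDecay u₀

namespace ClayDatum

variable (d : ClayDatum ι)

/-! ### The constants and the Fourier-side solution -/

omit [DecidableEq ι] in
/-- The heat rate `c = 4π²ν` (`νΔ ↔ -4π²ν‖ξ‖²` under `𝓕`). [folklore] -/
def c : ℝ := 4 * π ^ 2 * d.ν

omit [DecidableEq ι] in
/-- The integrable order `K₀ = card ι + 1`. [folklore] -/
def K₀ (_d : ClayDatum ι) : ℕ := Fintype.card ι + 1

omit [DecidableEq ι] in
/-- The Fourier datum `a = 𝓕⁻ u₀^ℂ` (componentwise). [folklore] -/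
def a : EuclideanSpace ℝ ι → ι → ℂ := fourierData d.smooth d.decay

omit [DecidableEq ι] in
/-- The order-`K₀` decay constant of the datum. [folklore] -/
def A : ℝ := (hasDecay_fourierData d.smooth d.decay d.K₀).choose

omit [DecidableEq ι] in
/-- The radius `R = 2A` of the Picard ball. [folklore] -/
def R : ℝ := 2 * d.A

/-- Picard's time `T = c/(4e C₀ R + 1)²`. [folklore] -/
def T : ℝ := picardTime ι d.c d.K₀ d.R

/-- The Fourier-side solution `v = picardLimit c T a`. [folklore] -/
def v : ℝ → EuclideanSpace ℝ ι → ι → ℂ := picardLimit d.c d.T d.a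

omit [DecidableEq ι] in
/-- `c > 0`. [folklore] -/
theorem c_pos : 0 < d.c := by unfold c; have := d.hν; positivity

omit [DecidableEq ι] in
/-- `K₀ > card ι`. [folklore] -/
theorem hK₀ : Fintype.card ι < d.K₀ := Nat.lt_succ_self _

omit [DecidableEq ι] in
/-- The datum lies in the ball of radius `A = R/2`. [folklore] -/
theorem decay_a : HasDecay d.K₀ (d.R / 2) d.a := by
  have h := (hasDecay_fourierData d.smooth d.decay d.K₀).choose_spec
  have : d.R / 2 = d.A := by unfold R; ring
  rw [this]; exact h

omit [DecidableEq ι] in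
/-- **The hypotheses of the Picard iteration hold.** [folklore] -/
theorem hyp : PicardHyp d.c d.K₀ d.R d.a where
  hc := d.c_pos
  hK₀ := d.hK₀
  cont := continuous_fourierData d.smooth d.decay
  decay := d.decay_a

omit [DecidableEq ι] in
/-- `T > 0`. [folklore] -/
theorem T_pos : 0 < d.T := d.hyp.time_pos

/-- `v` is jointly continuous. [folklore] -/
theorem continuous_v : Continuous (uncurry d.v) := d.hyp.continuous_limit rfl

/-- Time slices of `v` are continuous. [folklore] -/
theorem continuous_v_slice (t : ℝ) : Continuous (d.v t) := d.hyp.continuous_limit_slice rfl t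

/-- Components of time slices of `v` are a.e.-strongly measurable. [folklore] -/
theorem aesm_v (t : ℝ) (l : ι) : AEStronglyMeasurable (fun ξ => d.v t ξ l) volume :=
  aesm_apply (d.continuous_v_slice t).aestronglyMeasurable l

/-- `v` stays in the ball of radius `R`. [folklore] -/
theorem decay_v (t : ℝ) : HasDecay d.K₀ d.R (d.v t) := d.hyp.decay_limit rfl t

/-- **Every polynomial decay of `v`, uniformly in time.** [folklore] -/
theorem decay_v_all (K : ℕ) : ∃ B, ∀ t, HasDecay K B (d.v t) := by
  obtain ⟨A, hA⟩ := hasDecay_fourierData d.smooth d.decay K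
  exact ⟨_, fun t => d.hyp.decay_limit_high' rfl hA t⟩

/-- Component form of the uniform decay. [folklore] -/
theorem decay_v_apply (K : ℕ) (l : ι) : ∃ B, ∀ t, HasDecay K B (fun ξ => d.v t ξ l) := by
  obtain ⟨B, hB⟩ := d.decay_v_all K
  exact ⟨B, fun t => (hB t).apply l⟩

/-- `v 0 = a`. [folklore] -/
theorem v_zero (ξ : EuclideanSpace ℝ ι) : d.v 0 ξ = d.a ξ := d.hyp.limit_zero rfl ξ

/-- **`v` is divergence free on the Fourier side.** [folklore] -/
theorem sum_mul_v (t : ℝ) (ξ : EuclideanSpace ℝ ι) : ∑ l, (ξ l : ℂ) * d.v t ξ l = 0 :=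
  d.hyp.sum_mul_limit rfl (sum_mul_fourierData d.smooth d.decay d.divFree) t ξ

/-- **Conjugation symmetry of `v`.** [folklore] -/
theorem v_conj (t : ℝ) (ξ : EuclideanSpace ℝ ι) (l : ι) : d.v t (-ξ) l = conj (d.v t ξ l) :=
  d.hyp.limit_conj_symm rfl (fourierData_conj_symm d.smooth d.decay) t ξ l

/-- The time derivative of `v` within `[0, T]`: `∂ₜ v = -c‖ξ‖² v − N(v, v)`, componentwise. [folklore] -/
theorem hasDerivWithinAt_v (ξ : EuclideanSpace ℝ ι) {t : ℝ} (ht : t ∈ Icc 0 d.T) (l : ι) :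
    HasDerivWithinAt (fun s => d.v s ξ l)
      (-((d.c * ‖ξ‖ ^ 2 : ℝ) : ℂ) * d.v t ξ l - nonlin (d.v t) (d.v t) ξ l) (Icc 0 d.T) t :=
  d.hyp.hasDerivWithinAt_limit_apply rfl ξ ht l

/-- Families of all orders for `v` (componentwise). [folklore] -/
theorem exists_family (n : ℕ) : ∃ W : ℕ → ℝ → EuclideanSpace ℝ ι → ι → ℂ, W 0 = d.v ∧
    ∀ l, IsFourierFamily d.T n (fun k t ξ => W k t ξ l) :=
  d.hyp.exists_family rfl (hasDecay_fourierData d.smooth d.decay) n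

/-! ### The physical fields -/

omit [DecidableEq ι] in
/-- Real part, componentwise, as an `ℝ`-linear map `(ι → ℂ) → EuclideanSpace ℝ ι`. [folklore] -/
def reVec : (ι → ℂ) →L[ℝ] EuclideanSpace ℝ ι :=
  (EuclideanSpace.equiv ι ℝ).symm.toContinuousLinearMap.comp
    (ContinuousLinearMap.pi fun l => Complex.reCLM.comp (ContinuousLinearMap.proj l))

omit [Fintype ι] [DecidableEq ι] in
/-- Components of `reVec z` are the real parts. [folklore] -/
@[simp]
theorem reVec_apply (z : ι → ℂ) (l : ι) : reVec z l = (z l).re := rfl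

/-- The complex velocity components `U(t, x)_l = 𝓕 (v(t)_l)(x)`. [folklore] -/
def U (t : ℝ) (x : EuclideanSpace ℝ ι) (l : ι) : ℂ := 𝓕 (fun ξ => d.v t ξ l) x

/-- **The velocity** `u(t, x) = Re 𝓕 v(t)(x)`. [folklore] -/
def u (t : ℝ) (x : EuclideanSpace ℝ ι) : EuclideanSpace ℝ ι := reVec (d.U t x)

/-- The pressure symbol `q(t) = presSymbol (v t) (v t)`. [folklore] -/
def q (t : ℝ) (ξ : EuclideanSpace ℝ ι) : ℂ := presSymbol (d.v t) (d.v t) ξ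

/-- The complex pressure `P(t, x) = 𝓕 q(t)(x)`. [folklore] -/
def P (t : ℝ) (x : EuclideanSpace ℝ ι) : ℂ := 𝓕 (d.q t) x

/-- **The pressure** `p(t, x) = Re 𝓕 q(t)(x)`. [folklore] -/
def p (t : ℝ) (x : EuclideanSpace ℝ ι) : ℝ := (d.P t x).re

/-- Components of `u`. [folklore] -/
@[simp]
theorem u_apply (t : ℝ) (x : EuclideanSpace ℝ ι) (l : ι) : d.u t x l = (d.U t x l).re := rfl

/-- **Reality**: `U(t, x)_l ∈ ℝ`, i.e. `(u(t,x)_l : ℂ) = U(t,x)_l`. [folklore] -/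
theorem ofReal_u_apply (t : ℝ) (x : EuclideanSpace ℝ ι) (l : ι) : ((d.u t x l : ℝ) : ℂ) = d.U t x l := by
  rw [u_apply, U]
  exact (fourier_eq_re_of_conj_symm (fun ξ => d.v_conj t ξ l) x).symm

/-- **Initial value**: `u 0 = u₀`. [folklore] -/
theorem u_zero : d.u 0 = d.u₀ := by
  funext x
  ext l
  rw [u_apply, U]
  have h1 : (fun ξ => d.v 0 ξ l) = fun ξ => fourierData d.smooth d.decay ξ l := by
    funext ξ; rw [d.v_zero]; rfl
  rw [h1, fourier_fourierData d.smooth d.decay l]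
  simp

/-! ### Smoothness on the closed slab -/

/-- **The velocity is jointly smooth on `[0, T] × E`.** [folklore] -/
theorem smooth_u : IsSmoothSpaceTimeOn (Icc 0 d.T) d.u := by
  unfold IsSmoothSpaceTimeOn
  refine (contDiffOn_euclidean (ι := ι) (𝕜 := ℝ)).2 fun l => ?_
  have h : ContDiffOn ℝ ∞ (fun z : ℝ × EuclideanSpace ℝ ι => 𝓕 (fun ξ => d.v z.1 ξ l) z.2)
      (Icc 0 d.T ×ˢ univ) := by
    refine contDiffOn_synth_infty (W₀ := fun t ξ => d.v t ξ l) d.T_pos fun n => ?_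
    obtain ⟨W, hW0, hW⟩ := d.exists_family n
    exact ⟨fun k t ξ => W k t ξ l, by funext t ξ; simp only [hW0], hW l⟩
  have h2 := Complex.reCLM.contDiff.comp_contDiffOn h
  exact h2

/-- The pressure symbol has families of all orders. [folklore] -/
theorem exists_presFamily (n : ℕ) : ∃ Q : ℕ → ℝ → EuclideanSpace ℝ ι → ℂ,
    (∀ t ξ, Q 0 t ξ = d.q t ξ) ∧ IsFourierFamily d.T n Q :=
  d.hyp.exists_presFamily rfl (hasDecay_fourierData d.smooth d.decay) n

/-- **The pressure is jointly smooth on `[0, T] × E`.** [folklore] -/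
theorem smooth_p : IsSmoothSpaceTimeOn (Icc 0 d.T) d.p := by
  unfold IsSmoothSpaceTimeOn
  have h : ContDiffOn ℝ ∞ (fun z : ℝ × EuclideanSpace ℝ ι => 𝓕 (d.q z.1) z.2) (Icc 0 d.T ×ˢ univ) := by
    refine contDiffOn_synth_infty (W₀ := d.q) d.T_pos fun n => ?_
    obtain ⟨Q, hQ0, hQ⟩ := d.exists_presFamily n
    exact ⟨Q, by funext t ξ; exact hQ0 t ξ, hQ⟩
  exact Complex.reCLM.contDiff.comp_contDiffOn h


/-! ### Space derivatives of the velocity and the pressure -/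

/-- The `x`-derivative of a complex velocity component: `∂_h U_l = 𝓕 (-2πi⟪ξ,h⟫ v_l)`. [folklore] -/
theorem fderiv_U (t : ℝ) (x h : EuclideanSpace ℝ ι) (l : ι) :
    fderiv ℝ (fun x => d.U t x l) x h =
      𝓕 (fun ξ => (-(2 * π * I) * (⟪ξ, h⟫ : ℂ)) * d.v t ξ l) x := by
  obtain ⟨B, hB⟩ := d.decay_v_apply (1 + d.K₀) l
  exact fderiv_fourier_apply' d.hK₀ (hB t) (d.aesm_v t l) x h

/-- Complex velocity components are differentiable in `x`. [folklore] -/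
theorem differentiable_U (t : ℝ) (l : ι) : Differentiable ℝ (fun x => d.U t x l) := by
  obtain ⟨B, hB⟩ := d.decay_v_apply (1 + d.K₀) l
  exact differentiable_fourier' d.hK₀ (hB t) (d.aesm_v t l)

/-- Complex velocity components are `C^n` in `x` for every `n`. [folklore] -/
theorem contDiff_U (t : ℝ) (l : ι) (n : ℕ) : ContDiff ℝ n (fun x => d.U t x l) := by
  obtain ⟨B, hB⟩ := d.decay_v_apply (n + d.K₀) l
  exact contDiff_fourier' d.hK₀ (hB t) (d.aesm_v t l)

/-- The complex velocity vector `x ↦ (U(t,x)_l)_l` is differentiable. [folklore] -/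
theorem differentiableAt_Uvec (t : ℝ) (x : EuclideanSpace ℝ ι) : DifferentiableAt ℝ (d.U t) x :=
  differentiableAt_pi.2 fun l => (d.differentiable_U t l) x

/-- The complex velocity vector is `C^n`. [folklore] -/
theorem contDiff_Uvec (t : ℝ) (n : ℕ) : ContDiff ℝ n (d.U t) :=
  contDiff_pi' fun l => d.contDiff_U t l n

/-- `u t = reVec ∘ U t`. [folklore] -/
theorem u_eq_comp (t : ℝ) : d.u t = reVec ∘ d.U t := rfl

/-- **The velocity gradient**: `(Du(t) x h)_l = Re 𝓕 (-2πi⟪ξ,h⟫ v_l)(x)`. [folklore] -/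
theorem fderiv_u_apply (t : ℝ) (x h : EuclideanSpace ℝ ι) (l : ι) :
    fderiv ℝ (d.u t) x h l =
      (𝓕 (fun ξ => (-(2 * π * I) * (⟪ξ, h⟫ : ℂ)) * d.v t ξ l) x).re := by
  have h1 : HasFDerivAt (d.u t) ((reVec (ι := ι)).comp (fderiv ℝ (d.U t) x)) x := by
    rw [u_eq_comp]
    exact (reVec (ι := ι)).hasFDerivAt.comp x (d.differentiableAt_Uvec t x).hasFDerivAt
  rw [h1.fderiv, ContinuousLinearMap.comp_apply, reVec_apply]
  have h2 : fderiv ℝ (d.U t) x = ContinuousLinearMap.pi fun l => fderiv ℝ (fun x => d.U t x l) x := by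
    change fderiv ℝ (fun x l => d.U t x l) x = _
    exact fderiv_pi fun l => (d.differentiable_U t l) x
  rw [h2, ContinuousLinearMap.pi_apply, d.fderiv_U]

omit [DecidableEq ι] in
/-- The real inner product on `EuclideanSpace ℝ ι` in coordinates. [folklore] -/
theorem inner_eq_sum' (ξ y : EuclideanSpace ℝ ι) : ⟪ξ, y⟫ = ∑ j, ξ j * y j := by
  rw [PiLp.inner_apply]
  refine Finset.sum_congr rfl fun j _ => ?_
  simp [mul_comm]

/-- **The velocity is divergence free** for every `t`. [folklore] -/
theorem isDivFree_u (t : ℝ) : VectorCalculus.IsDivFree (d.u t) := by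
  classical
  intro x
  rw [divergence_eq_sum_inner_fderiv (EuclideanSpace.basisFun ι ℝ)]
  have hterm : ∀ l, ⟪(EuclideanSpace.basisFun ι ℝ) l, fderiv ℝ (d.u t) x ((EuclideanSpace.basisFun ι ℝ) l)⟫ =
      (𝓕 (fun ξ => (-(2 * π * I) * ((ξ l : ℝ) : ℂ)) * d.v t ξ l) x).re := by
    intro l
    rw [EuclideanSpace.basisFun_apply, EuclideanSpace.inner_single_left, d.fderiv_u_apply]
    simp only [conj_trivial, one_mul, EuclideanSpace.inner_single_right]
  simp_rw [hterm]
  rw [← Complex.re_sum]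
  obtain ⟨B, hB⟩ := d.decay_v_all (1 + d.K₀)
  have hint : ∀ l ∈ (Finset.univ : Finset ι), Integrable fun ξ : EuclideanSpace ℝ ι =>
      (-(2 * π * I) * ((ξ l : ℝ) : ℂ)) * d.v t ξ l := by
    intro l _
    have hd : HasDecay d.K₀ (2 * π * B) fun ξ : EuclideanSpace ℝ ι =>
        (-(2 * π * I) * ((ξ l : ℝ) : ℂ)) * d.v t ξ l := by
      have := ((hB t).apply l)
      rw [Nat.add_comm] at this
      refine this.mul_linear (by positivity) fun ξ => ?_
      rw [norm_mul, norm_neg, norm_mul, norm_mul, Complex.norm_two, Complex.norm_real,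
        Complex.norm_I, mul_one, Real.norm_eq_abs, abs_of_pos Real.pi_pos, Complex.norm_real,
        Real.norm_eq_abs]
      exact mul_le_mul_of_nonneg_left (abs_apply_le_norm ξ l) (by positivity)
    exact hd.integrable (finrank_lt_of_card_lt d.hK₀)
      ((Continuous.aestronglyMeasurable (by fun_prop)).mul (d.aesm_v t l))
  rw [← fourier_finset_sum' Finset.univ hint]
  have hzero : (fun ξ : EuclideanSpace ℝ ι => ∑ l, (-(2 * π * I) * ((ξ l : ℝ) : ℂ)) * d.v t ξ l) =
      fun _ => 0 := by
    funext ξ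
    have := d.sum_mul_v t ξ
    calc ∑ l, (-(2 * π * I) * ((ξ l : ℝ) : ℂ)) * d.v t ξ l
        = -(2 * π * I) * ∑ l, ((ξ l : ℝ) : ℂ) * d.v t ξ l := by
          rw [Finset.mul_sum]; refine Finset.sum_congr rfl fun l _ => ?_; ring
      _ = 0 := by rw [this, mul_zero]
  rw [hzero, fourier_zero', Complex.zero_re]

/-- **The Laplacian of the velocity**: `(Δu(t) x)_l = Re 𝓕 (-4π²‖ξ‖² v_l)(x)`. [folklore] -/
theorem laplacian_u_apply (t : ℝ) (x : EuclideanSpace ℝ ι) (l : ι) :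
    (Δ (d.u t)) x l = (𝓕 (fun ξ => (-(4 * π ^ 2 * ‖ξ‖ ^ 2 : ℝ) : ℂ) * d.v t ξ l) x).re := by
  have h2 : ContDiffAt ℝ 2 (d.U t) x := (d.contDiff_Uvec t 2).contDiffAt
  have h1 : (Δ (d.u t)) x = reVec ((Δ (d.U t)) x) := by
    rw [u_eq_comp]
    exact ContDiffAt.laplacian_CLM_comp_left h2
  rw [h1, reVec_apply]
  have h3 : (Δ (d.U t)) x l = (Δ (fun x => d.U t x l)) x := by
    have := ContDiffAt.laplacian_CLM_comp_left (l := ContinuousLinearMap.proj (R := ℝ) l) h2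
    exact this.symm
  rw [h3]
  obtain ⟨B, hB⟩ := d.decay_v_apply (2 + d.K₀) l
  have h4 : (fun x => d.U t x l) = 𝓕 (fun ξ => d.v t ξ l) := rfl
  rw [h4, laplacian_fourier' d.hK₀ (hB t) (d.aesm_v t l)]

/-! ### The pressure gradient -/

/-- Measurability of the pressure symbol's time slices. [folklore] -/
theorem aesm_q (t : ℝ) : AEStronglyMeasurable (d.q t) volume := by
  have hint : ∀ j, Integrable fun ξ => d.v t ξ j := fun j =>
    ((d.decay_v t).apply j).integrable (finrank_lt_of_card_lt d.hK₀) (d.aesm_v t j)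
  unfold q presSymbol
  refine AEStronglyMeasurable.neg ?_
  refine Finset.aestronglyMeasurable_fun_sum _ fun j _ => Finset.aestronglyMeasurable_fun_sum _
    fun k _ => ?_
  exact ((measurable_presMultiplier j k).complex_ofReal.aestronglyMeasurable).mul
    (aestronglyMeasurable_fconv (hint j) (hint k))

/-- Every polynomial decay of the pressure symbol, uniformly in time. [folklore] -/
theorem decay_q (K : ℕ) : ∃ B, ∀ t, HasDecay K B (d.q t) := by
  obtain ⟨BK, hBK⟩ := d.decay_v_all K
  refine ⟨(Fintype.card ι : ℝ) ^ 2 * (2 ^ K * weightMass (EuclideanSpace ℝ ι) d.K₀ *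
    (BK * d.R + d.R * BK)), fun t ξ => ?_⟩
  exact (norm_presSymbol_le_mixed d.hK₀ (d.decay_v t) (hBK t) (d.decay_v t) (hBK t)
    (d.continuous_v_slice t).aestronglyMeasurable (d.continuous_v_slice t).aestronglyMeasurable ξ).trans
    (le_of_eq (by ring))

/-- The `x`-derivative of the complex pressure: `∂_h P = 𝓕 (-2πi⟪ξ,h⟫ q)`. [folklore] -/
theorem fderiv_P (t : ℝ) (x h : EuclideanSpace ℝ ι) :
    fderiv ℝ (d.P t) x h = 𝓕 (fun ξ => (-(2 * π * I) * (⟪ξ, h⟫ : ℂ)) * d.q t ξ) x := by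
  obtain ⟨B, hB⟩ := d.decay_q (1 + d.K₀)
  exact fderiv_fourier_apply' d.hK₀ (hB t) (d.aesm_q t) x h

/-- The complex pressure is differentiable in `x`. [folklore] -/
theorem differentiable_P (t : ℝ) : Differentiable ℝ (d.P t) := by
  obtain ⟨B, hB⟩ := d.decay_q (1 + d.K₀)
  exact differentiable_fourier' d.hK₀ (hB t) (d.aesm_q t)

/-- **The pressure gradient**: `(∇p(t) x)_l = Re 𝓕 (-2πi ξ_l q)(x)`. [folklore] -/
theorem gradient_p_apply (t : ℝ) (x : EuclideanSpace ℝ ι) (l : ι) :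
    gradient (d.p t) x l = (𝓕 (fun ξ => (-(2 * π * I) * ((ξ l : ℝ) : ℂ)) * d.q t ξ) x).re := by
  classical
  have h1 : gradient (d.p t) x l = fderiv ℝ (d.p t) x (EuclideanSpace.single l (1 : ℝ)) := by
    have : gradient (d.p t) x l = ⟪gradient (d.p t) x, EuclideanSpace.single l (1 : ℝ)⟫ := by
      rw [EuclideanSpace.inner_single_right]; simp
    rw [this, gradient, InnerProductSpace.toDual_symm_apply]
  have h2 : HasFDerivAt (d.p t) (Complex.reCLM.comp (fderiv ℝ (d.P t) x)) x := by
    have : d.p t = Complex.reCLM ∘ d.P t := rfl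
    rw [this]
    exact Complex.reCLM.hasFDerivAt.comp x ((d.differentiable_P t) x).hasFDerivAt
  rw [h1, h2.fderiv, ContinuousLinearMap.comp_apply, Complex.reCLM_apply, d.fderiv_P]
  refine congrArg Complex.re (congrFun (fourier_congr' fun ξ => ?_) x)
  rw [EuclideanSpace.inner_single_right]
  simp

/-! ### The time derivative -/

/-- **The time derivative of the velocity within `[0, T]`**:
`∂ₜ u(t, x)_l = Re 𝓕 (-c‖ξ‖² v_l − N(v,v)_l)(x)`. [folklore] -/
theorem hasDerivWithinAt_u (x : EuclideanSpace ℝ ι) {t : ℝ} (ht : t ∈ Icc 0 d.T) :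
    HasDerivWithinAt (fun s => d.u s x)
      (reVec fun l => 𝓕 (fun ξ => -((d.c * ‖ξ‖ ^ 2 : ℝ) : ℂ) * d.v t ξ l -
        nonlin (d.v t) (d.v t) ξ l) x) (Icc 0 d.T) t := by
  obtain ⟨W, hW0, hW⟩ := d.exists_family 1
  have hU : ∀ l, HasDerivWithinAt (fun s => d.U s x l)
      (𝓕 (fun ξ => -((d.c * ‖ξ‖ ^ 2 : ℝ) : ℂ) * d.v t ξ l - nonlin (d.v t) (d.v t) ξ l) x)
      (Icc 0 d.T) t := by
    intro l
    have h := hasDerivWithinAt_synth_time (n := 0) d.T_pos (hW l) x ht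
    have hsynth : (fun s => synth (fun k t ξ => W k t ξ l) (s, x)) = fun s => d.U s x l := by
      funext s; simp only [synth, hW0]; rfl
    rw [hsynth] at h
    -- identify `W 1 t ξ l` with the right-hand side by uniqueness of one-sided derivatives
    have hW1 : ∀ ξ, W 1 t ξ l = -((d.c * ‖ξ‖ ^ 2 : ℝ) : ℂ) * d.v t ξ l - nonlin (d.v t) (d.v t) ξ l := by
      intro ξ
      have h1 := (hW l).deriv 0 Nat.zero_lt_one ξ t ht
      simp only [hW0, zero_add] at h1
      have h2 := d.hasDerivWithinAt_v ξ ht l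
      have hud : UniqueDiffWithinAt ℝ (Icc 0 d.T) t := uniqueDiffOn_Icc d.T_pos t ht
      rw [← h1.derivWithin hud, ← h2.derivWithin hud]
    have hval : synth (fun k => fun t ξ => W (k + 1) t ξ l) (t, x) =
        𝓕 (fun ξ => -((d.c * ‖ξ‖ ^ 2 : ℝ) : ℂ) * d.v t ξ l - nonlin (d.v t) (d.v t) ξ l) x := by
      simp only [synth, zero_add]
      rw [show (fun ξ => W 1 t ξ l) = fun ξ => -((d.c * ‖ξ‖ ^ 2 : ℝ) : ℂ) * d.v t ξ l -
        nonlin (d.v t) (d.v t) ξ l from funext hW1]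
    rw [hval] at h
    exact h
  have hvec : HasDerivWithinAt (fun s => d.U s x)
      (fun l => 𝓕 (fun ξ => -((d.c * ‖ξ‖ ^ 2 : ℝ) : ℂ) * d.v t ξ l - nonlin (d.v t) (d.v t) ξ l) x)
      (Icc 0 d.T) t := hasDerivWithinAt_pi.2 hU
  exact (reVec (ι := ι)).hasFDerivAt.comp_hasDerivWithinAt t hvec

/-- The one-sided time derivative of `u`. [folklore] -/
theorem timeDerivWithin_u (x : EuclideanSpace ℝ ι) {t : ℝ} (ht : t ∈ Icc 0 d.T) :
    timeDerivWithin (Icc 0 d.T) d.u t x =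
      reVec fun l => 𝓕 (fun ξ => -((d.c * ‖ξ‖ ^ 2 : ℝ) : ℂ) * d.v t ξ l -
        nonlin (d.v t) (d.v t) ξ l) x := by
  rw [timeDerivWithin_apply]
  exact (d.hasDerivWithinAt_u x ht).derivWithin (uniqueDiffOn_Icc d.T_pos t ht)

/-! ### The convective term -/

/-- The transformed convective term `G(t)(ξ)_l = ∑ⱼ (v_j ⋆ (-2πi ζ_j v_l))(ξ)`. [folklore] -/
def G (t : ℝ) (ξ : EuclideanSpace ℝ ι) (l : ι) : ℂ :=
  ∑ j, fconv (fun η => d.v t η j) (fun ζ => (-(2 * π * I) * ((ζ j : ℝ) : ℂ)) * d.v t ζ l) ξ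

/-- The derivative-weighted components `-2πi ζ_j v_l` are integrable with decay of order `K₀`. [folklore] -/
theorem hasDecay_dv (t : ℝ) (j l : ι) : ∃ B, HasDecay d.K₀ B (fun ζ : EuclideanSpace ℝ ι =>
    (-(2 * π * I) * ((ζ j : ℝ) : ℂ)) * d.v t ζ l) ∧
    AEStronglyMeasurable (fun ζ : EuclideanSpace ℝ ι => (-(2 * π * I) * ((ζ j : ℝ) : ℂ)) * d.v t ζ l)
      volume := by
  obtain ⟨B, hB⟩ := d.decay_v_all (1 + d.K₀)
  refine ⟨2 * π * B, ?_, (Continuous.aestronglyMeasurable (by fun_prop)).mul (d.aesm_v t l)⟩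
  have := ((hB t).apply l)
  rw [Nat.add_comm] at this
  refine this.mul_linear (by positivity) fun ξ => ?_
  rw [norm_mul, norm_neg, norm_mul, norm_mul, Complex.norm_two, Complex.norm_real,
    Complex.norm_I, mul_one, Real.norm_eq_abs, abs_of_pos Real.pi_pos, Complex.norm_real,
    Real.norm_eq_abs]
  exact mul_le_mul_of_nonneg_left (abs_apply_le_norm ξ j) (by positivity)

/-- **The convective term**: `((u·∇)u (t, x))_l = Re 𝓕 (G(t)_l)(x)` (reality of `U`, linearity
and the convolution theorem). [folklore] -/
theorem convect_u_apply (t : ℝ) (x : EuclideanSpace ℝ ι) (l : ι) :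
    convect (d.u t) (d.u t) x l = (𝓕 (fun ξ => d.G t ξ l) x).re := by
  rw [convect_apply, d.fderiv_u_apply]
  congr 1
  -- expand `⟪ξ, u⟫ = ∑ⱼ ξⱼ uⱼ` with `uⱼ = U_j` real
  have hexp : (fun ξ : EuclideanSpace ℝ ι => (-(2 * π * I) * (⟪ξ, d.u t x⟫ : ℂ)) * d.v t ξ l) =
      fun ξ => ∑ j, d.U t x j * ((-(2 * π * I) * ((ξ j : ℝ) : ℂ)) * d.v t ξ l) := by
    funext ξ
    rw [inner_eq_sum', Complex.ofReal_sum]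
    simp_rw [Complex.ofReal_mul, d.ofReal_u_apply]
    rw [Finset.mul_sum, Finset.sum_mul]
    refine Finset.sum_congr rfl fun j _ => ?_
    ring
  rw [hexp]
  have hint : ∀ j ∈ (Finset.univ : Finset ι), Integrable fun ξ : EuclideanSpace ℝ ι =>
      d.U t x j * ((-(2 * π * I) * ((ξ j : ℝ) : ℂ)) * d.v t ξ l) := by
    intro j _
    obtain ⟨B, hB, hm⟩ := d.hasDecay_dv t j l
    exact (hB.integrable (finrank_lt_of_card_lt d.hK₀) hm).const_mul _
  rw [fourier_finset_sum' Finset.univ hint]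
  have hvj : ∀ j, Integrable fun ξ => d.v t ξ j := fun j =>
    ((d.decay_v t).apply j).integrable (finrank_lt_of_card_lt d.hK₀) (d.aesm_v t j)
  have hterm : ∀ j, 𝓕 (fun ξ : EuclideanSpace ℝ ι => d.U t x j *
      ((-(2 * π * I) * ((ξ j : ℝ) : ℂ)) * d.v t ξ l)) x =
      𝓕 (fconv (fun η => d.v t η j) (fun ζ => (-(2 * π * I) * ((ζ j : ℝ) : ℂ)) * d.v t ζ l)) x := by
    intro j
    obtain ⟨B, hB, hm⟩ := d.hasDecay_dv t j l
    rw [fourier_const_mul', U, fourier_mul_fourier' (hvj j) (hB.integrable (finrank_lt_of_card_lt d.hK₀) hm)]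
  simp_rw [hterm]
  have hint2 : ∀ j ∈ (Finset.univ : Finset ι), Integrable
      (fconv (fun η => d.v t η j) (fun ζ => (-(2 * π * I) * ((ζ j : ℝ) : ℂ)) * d.v t ζ l)) := by
    intro j _
    obtain ⟨B, hB, hm⟩ := d.hasDecay_dv t j l
    exact integrable_fconv (hvj j) (hB.integrable (finrank_lt_of_card_lt d.hK₀) hm)
  rw [← fourier_finset_sum' Finset.univ hint2]
  rfl

/-- **Incompressibility inside the convolution**: `G_l = -2πi ∑ⱼ ξⱼ (v_j ⋆ v_l)`
(`∑ⱼ ηⱼ vⱼ(η) = 0` under the integral). [folklore] -/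
theorem G_eq (t : ℝ) (ξ : EuclideanSpace ℝ ι) (l : ι) :
    d.G t ξ l = -(2 * π * I) * ∑ j, ((ξ j : ℝ) : ℂ) * fconv (fun η => d.v t η j) (fun η => d.v t η l) ξ := by
  have hvj : ∀ j, Integrable fun ξ => d.v t ξ j := fun j =>
    ((d.decay_v t).apply j).integrable (finrank_lt_of_card_lt d.hK₀) (d.aesm_v t j)
  -- integrability of the two pieces of each convolution integrand
  have hI1 : ∀ j, Integrable fun η => d.v t η j * d.v t (ξ - η) l := fun j =>
    (fconv_bound_mixed d.hK₀ ((d.decay_v t).apply j) ((d.decay_v t).apply j)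
      ((d.decay_v t).apply l) ((d.decay_v t).apply l) (d.aesm_v t j) (d.aesm_v t l) ξ).1
  have hI2 : ∀ j, Integrable fun η => (((η j : ℝ) : ℂ) * d.v t η j) * d.v t (ξ - η) l := by
    intro j
    obtain ⟨B, hB⟩ := d.decay_v_all (1 + d.K₀)
    have hdec : HasDecay d.K₀ (1 * B) fun η : EuclideanSpace ℝ ι => ((η j : ℝ) : ℂ) * d.v t η j := by
      have := ((hB t).apply j)
      rw [Nat.add_comm] at this
      refine this.mul_linear zero_le_one fun η => ?_
      rw [Complex.norm_real, Real.norm_eq_abs, one_mul]; exact abs_apply_le_norm η j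
    have hm : AEStronglyMeasurable (fun η : EuclideanSpace ℝ ι => ((η j : ℝ) : ℂ) * d.v t η j) volume :=
      (Continuous.aestronglyMeasurable (by fun_prop)).mul (d.aesm_v t j)
    exact (fconv_bound_mixed d.hK₀ hdec hdec ((d.decay_v t).apply l) ((d.decay_v t).apply l) hm
      (d.aesm_v t l) ξ).1
  -- split each convolution
  have hsplit : ∀ j, fconv (fun η => d.v t η j) (fun ζ => (-(2 * π * I) * ((ζ j : ℝ) : ℂ)) * d.v t ζ l) ξ =
      -(2 * π * I) * (((ξ j : ℝ) : ℂ) * fconv (fun η => d.v t η j) (fun η => d.v t η l) ξ) +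
        (2 * π * I) * ∫ η, (((η j : ℝ) : ℂ) * d.v t η j) * d.v t (ξ - η) l := by
    intro j
    rw [fconv_apply, fconv_apply, ← integral_const_mul, ← integral_const_mul, ← integral_const_mul,
      ← integral_add ((hI1 j).const_mul _ |>.const_mul _) ((hI2 j).const_mul _)]
    refine integral_congr_ae (Eventually.of_forall fun η => ?_)
    simp only [PiLp.sub_apply, Complex.ofReal_sub]
    ring
  unfold G
  simp_rw [hsplit]
  rw [Finset.sum_add_distrib, ← Finset.mul_sum, ← Finset.mul_sum]
  -- the second sum vanishes by incompressibility of `v t`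
  have hzero : ∑ j, ∫ η, (((η j : ℝ) : ℂ) * d.v t η j) * d.v t (ξ - η) l = 0 := by
    rw [← integral_finsetSum Finset.univ fun j _ => hI2 j]
    have : (fun η : EuclideanSpace ℝ ι => ∑ j, (((η j : ℝ) : ℂ) * d.v t η j) * d.v t (ξ - η) l) =
        fun _ => 0 := by
      funext η
      rw [← Finset.sum_mul, d.sum_mul_v t η, zero_mul]
    rw [this, integral_zero]
  rw [hzero, mul_zero, add_zero]

/-- **The Fourier-side momentum identity**: `G_l − N(v,v)_l − 2πi ξ_l q = 0` pointwise
(the Leray projection removes exactly the gradient part; Lemarié-Rieusset 2016, §6.1). [folklore] -/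
theorem G_sub_nonlin_sub (t : ℝ) (ξ : EuclideanSpace ℝ ι) (l : ι) :
    d.G t ξ l - nonlin (d.v t) (d.v t) ξ l - (2 * π * I) * ((ξ l : ℝ) : ℂ) * d.q t ξ = 0 := by
  set C : ι → ι → ℂ := fun j k => fconv (fun η => d.v t η j) (fun η => d.v t η k) ξ with hC
  have hG : d.G t ξ l = -(2 * π * I) * ∑ j, ((ξ j : ℝ) : ℂ) * C j l := d.G_eq t ξ l
  have hN : nonlin (d.v t) (d.v t) ξ l = -(2 * π * I) * ∑ j, ((ξ j : ℝ) : ℂ) * C j l +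
      (2 * π * I) * ((ξ l : ℝ) : ℂ) * ∑ j, ∑ k, ((ξ j * ξ k / ‖ξ‖ ^ 2 : ℝ) : ℂ) * C j k := by
    rw [nonlin_apply]
    change -(2 * π * I) * ∑ j, ∑ k, (lerayDerivSymbol j k l ξ : ℂ) * C j k = _
    have hinner : ∀ j, ∑ k, (lerayDerivSymbol j k l ξ : ℂ) * C j k =
        ((ξ j : ℝ) : ℂ) * C j l - ((ξ l : ℝ) : ℂ) * ∑ k, (((ξ j * ξ k / ‖ξ‖ ^ 2 : ℝ) : ℂ) * C j k) := by
      intro j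
      have hk : ∀ k, (lerayDerivSymbol j k l ξ : ℂ) * C j k =
          (if k = l then ((ξ j : ℝ) : ℂ) * C j k else 0) -
            ((ξ l : ℝ) : ℂ) * ((((ξ j * ξ k / ‖ξ‖ ^ 2 : ℝ)) : ℂ) * C j k) := by
        intro k
        rw [lerayDerivSymbol_apply]
        split_ifs with hkl
        · push_cast; ring
        · push_cast; ring
      simp_rw [hk]
      rw [Finset.sum_sub_distrib, Finset.sum_ite_eq' Finset.univ l, if_pos (Finset.mem_univ l),
        Finset.mul_sum]
    simp_rw [hinner]
    rw [Finset.sum_sub_distrib, mul_sub, Finset.mul_sum, Finset.mul_sum, Finset.mul_sum,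
      sub_eq_add_neg, ← Finset.sum_neg_distrib]
    congr 1
    refine Finset.sum_congr rfl fun j _ => ?_
    ring
  have hq : d.q t ξ = -∑ j, ∑ k, ((ξ j * ξ k / ‖ξ‖ ^ 2 : ℝ) : ℂ) * C j k := rfl
  rw [hG, hN, hq]
  ring

/-! ### The Navier–Stokes system -/

/-- Integrability of the Fourier-side time derivative `-c‖ξ‖² v_l − N_l`. [folklore] -/
theorem integrable_Dt (t : ℝ) (l : ι) : Integrable fun ξ : EuclideanSpace ℝ ι =>
    -((d.c * ‖ξ‖ ^ 2 : ℝ) : ℂ) * d.v t ξ l - nonlin (d.v t) (d.v t) ξ l := by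
  obtain ⟨B2, hB2⟩ := d.decay_v_all (2 + d.K₀)
  have h1 : HasDecay d.K₀ (d.c * B2) fun ξ : EuclideanSpace ℝ ι => -((d.c * ‖ξ‖ ^ 2 : ℝ) : ℂ) * d.v t ξ l := by
    have := ((hB2 t).apply l)
    rw [Nat.add_comm] at this
    exact this.mul_growth d.c_pos.le (norm_heatSymbol_le d.c_pos.le)
  obtain ⟨B1, hB1⟩ := d.decay_v_all (d.K₀ + 1)
  have h2 : HasDecay d.K₀ (nonlinConst ι (d.K₀ + 1) d.K₀ * (B1 * d.R + d.R * B1))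
      (nonlin (d.v t) (d.v t)) :=
    hasDecay_nonlin d.hK₀ (d.decay_v t) (hB1 t) (d.decay_v t) (hB1 t)
      (d.continuous_v_slice t).aestronglyMeasurable (d.continuous_v_slice t).aestronglyMeasurable
  have hm1 : AEStronglyMeasurable (fun ξ : EuclideanSpace ℝ ι => -((d.c * ‖ξ‖ ^ 2 : ℝ) : ℂ) * d.v t ξ l)
      volume := (Continuous.aestronglyMeasurable (by fun_prop)).mul (d.aesm_v t l)
  have hm2 : AEStronglyMeasurable (fun ξ => nonlin (d.v t) (d.v t) ξ l) volume :=
    aesm_apply (continuous_nonlin_time d.hK₀ d.continuous_v d.decay_v |> fun h =>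
      (continuous_nonlin_param (X := EuclideanSpace ℝ ι) d.hK₀ (V := fun _ => d.v t) (W := fun _ => d.v t)
        (ζ := id) (fun _ => (d.continuous_v_slice t).aestronglyMeasurable)
        (fun _ => (d.continuous_v_slice t).aestronglyMeasurable) (fun _ => d.decay_v t)
        (fun _ => d.decay_v t) (fun η => continuous_const)
        (fun η => (d.continuous_v_slice t).comp (continuous_id.sub continuous_const))
        continuous_id).aestronglyMeasurable) l
  exact (h1.integrable (finrank_lt_of_card_lt d.hK₀) hm1).sub
    ((h2.apply l).integrable (finrank_lt_of_card_lt d.hK₀) hm2)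

/-- Integrability of `G_l`. [folklore] -/
theorem integrable_G (t : ℝ) (l : ι) : Integrable fun ξ => d.G t ξ l := by
  have hvj : ∀ j, Integrable fun ξ => d.v t ξ j := fun j =>
    ((d.decay_v t).apply j).integrable (finrank_lt_of_card_lt d.hK₀) (d.aesm_v t j)
  refine integrable_finsetSum _ fun j _ => ?_
  obtain ⟨B, hB, hm⟩ := d.hasDecay_dv t j l
  exact integrable_fconv (hvj j) (hB.integrable (finrank_lt_of_card_lt d.hK₀) hm)

/-- Integrability of `-4π²‖ξ‖² v_l`. [folklore] -/
theorem integrable_lap (t : ℝ) (l : ι) : Integrable fun ξ : EuclideanSpace ℝ ι =>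
    (-(4 * π ^ 2 * ‖ξ‖ ^ 2 : ℝ) : ℂ) * d.v t ξ l := by
  obtain ⟨B2, hB2⟩ := d.decay_v_all (2 + d.K₀)
  have h1 : HasDecay d.K₀ ((4 * π ^ 2) * B2) fun ξ : EuclideanSpace ℝ ι =>
      (-(4 * π ^ 2 * ‖ξ‖ ^ 2 : ℝ) : ℂ) * d.v t ξ l := by
    have := ((hB2 t).apply l)
    rw [Nat.add_comm] at this
    exact this.mul_growth (by positivity) (norm_heatSymbol_le (by positivity))
  exact h1.integrable (finrank_lt_of_card_lt d.hK₀)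
    ((Continuous.aestronglyMeasurable (by fun_prop)).mul (d.aesm_v t l))

/-- Integrability of `-2πi ξ_l q`. [folklore] -/
theorem integrable_gradq (t : ℝ) (l : ι) : Integrable fun ξ : EuclideanSpace ℝ ι =>
    (-(2 * π * I) * ((ξ l : ℝ) : ℂ)) * d.q t ξ := by
  obtain ⟨B, hB⟩ := d.decay_q (1 + d.K₀)
  have h1 : HasDecay d.K₀ (2 * π * B) fun ξ : EuclideanSpace ℝ ι =>
      (-(2 * π * I) * ((ξ l : ℝ) : ℂ)) * d.q t ξ := by
    have := hB t
    rw [Nat.add_comm] at this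
    refine this.mul_linear (by positivity) fun ξ => ?_
    rw [norm_mul, norm_neg, norm_mul, norm_mul, Complex.norm_two, Complex.norm_real,
      Complex.norm_I, mul_one, Real.norm_eq_abs, abs_of_pos Real.pi_pos, Complex.norm_real,
      Real.norm_eq_abs]
    exact mul_le_mul_of_nonneg_left (abs_apply_le_norm ξ l) (by positivity)
  exact h1.integrable (finrank_lt_of_card_lt d.hK₀)
    ((Continuous.aestronglyMeasurable (by fun_prop)).mul (d.aesm_q t))

/-- **The momentum equation** on `[0, T] × E`:
`∂ₜu + (u·∇)u = νΔu − ∇p` (componentwise: linearity of `𝓕` and `G − N − 2πi ξ q = 0`). [folklore] -/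
theorem momentum {t : ℝ} (ht : t ∈ Icc 0 d.T) (x : EuclideanSpace ℝ ι) :
    timeDerivWithin (Icc 0 d.T) d.u t x + convect (d.u t) (d.u t) x =
      d.ν • (Δ (d.u t)) x - gradient (d.p t) x + (0 : ℝ → EuclideanSpace ℝ ι → EuclideanSpace ℝ ι) t x := by
  rw [Pi.zero_apply, Pi.zero_apply, add_zero]
  ext l
  rw [PiLp.add_apply, PiLp.sub_apply, PiLp.smul_apply, d.timeDerivWithin_u x ht, reVec_apply,
    d.convect_u_apply, d.laplacian_u_apply, d.gradient_p_apply, smul_eq_mul]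
  -- reduce to an identity of complex Fourier integrals
  rw [← Complex.add_re, ← Complex.re_ofReal_mul, ← Complex.sub_re]
  congr 1
  rw [← fourier_add' (d.integrable_Dt t l) (d.integrable_G t l),
    ← fourier_const_mul' (d.ν : ℂ), ← fourier_sub' ((d.integrable_lap t l).const_mul _)
      (d.integrable_gradq t l)]
  refine congrFun (fourier_congr' fun ξ => ?_) x
  simp only [Pi.add_apply, Pi.sub_apply]
  have key := d.G_sub_nonlin_sub t ξ l
  have hc : ((d.c * ‖ξ‖ ^ 2 : ℝ) : ℂ) = (d.ν : ℂ) * ((4 * π ^ 2 * ‖ξ‖ ^ 2 : ℝ) : ℂ) := by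
    unfold c; push_cast; ring
  rw [hc]
  linear_combination key

/-- **`(u, p)` is a classical solution of the Navier–Stokes system on the closed slab
`[0, T] × E`** (Leray 1934, §19; Ożański–Pooley 2018, Thm. 6.22 & Cor. 6.16). [folklore] -/
theorem isClassicalNSSolutionOn : IsClassicalNSSolutionOn (Icc 0 d.T) d.ν 0 d.u d.p where
  smooth_velocity := d.smooth_u
  smooth_pressure := d.smooth_p
  momentum _ ht x := d.momentum ht x
  divFree t _ := d.isDivFree_u t

end ClayDatum

end Literature.Analysis.FluidPDE.FourierNS

end
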